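import Literature.NumberTheory.Automorphic.LevelActionHeckeRestriction
import Literature.NumberTheory.Automorphic.HidaLemmaGL2
import HarnessLib

/-!
# Hida's lemma (independence of the level at `p` of ordinary parts) in the coefficients-at-`p` model

Topic `NumberTheory/Automorphic`; namespace `Literature.NumberTheory.Automorphic.LevelAction`;
definitions with bodies and theorems (universe `0`), continuing `LevelActionTwoLevelHecke` /
`LevelActionHeckeRestriction`.  The `LevelAction` analogue of `HidaLemmaGL2` ([KhareThorne2017, §6.3,
Lemma 6.10]; [Hida1994AIF, §2]):

* `heckeRepHom₂ ι Δ τ hU hU' hα : M(U', τ) → M(U, τ)` — the two-level operator `[U α U']`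
  (`U' ≤ U ⊆ Δ`, `α ∈ Δ`) as a `Γ`-morphism, and `heckeCohomology₂` on `H^i`;
* **`heckeRepHom₂_comp_resRepHom_of_C₁`** (`[U α U'] ≫ res = [U' α U']`) and
  **`resRepHom_comp_heckeRepHom₂_of_C₂`** (`res ≫ [U α U'] = [U α U]`), with the cohomology versions;
* **`bijOn_resCohomology_of_C₁_C₂`** — Hida's lemma: `res : V₀ → W₀` is a bijection for subspaces
  exchanged by `res` and `[U α U']` on which `[UαU]` is injective / `[U'αU']` is surjective
  (`bijOn_of_comp_eq`), and **`bijOn_resCohomology_iInf_range_of_C₁_C₂`** for the ordinary parts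
  `⋂ₘ range [UαU]^m`;
* the `GL₂` instance for the one-place level step `levelAt Λ' ≤ levelAt Λ` of `HidaLemmaGL2`
  (`C₁ = exists_levelAt_coset_eq`, `C₂ = levelAt_coset_eq_of_conj_mem`):
  **`bijOn_resCohomology_iInf_range_levelAt`**.

## References

* C. Khare, J. A. Thorne, Amer. J. Math. 139 (2017), §6.3, Lemma 6.10 (arXiv:1409.7007, held). [KhareThorne2017]
* H. Hida, Ann. Inst. Fourier 44 (1994), §2 (held). [Hida1994AIF]
-/

noncomputable section

open CategoryTheory IsDedekindDomain NumberField

namespace Literature.NumberTheory.Automorphic.LevelAction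

section Generic

variable {R : Type} [CommRing R] {Γ 𝒢 : Type} [Group Γ] [Group 𝒢] (ι : Γ →* 𝒢) (Δ : Submonoid 𝒢)
  {V : Type} [AddCommGroup V] [Module R V] (τ : Δ →* Module.End R V) {U U' : Subgroup 𝒢}
  (hU : U.toSubmonoid ≤ Δ) (hU' : U'.toSubmonoid ≤ Δ) (hle : U' ≤ U)

/-- **`[U α U'] : M(U', τ) → M(U, τ)`** as a morphism of `Γ`-representations (`α ∈ Δ ⊇ U, U'`).
[cite: KhareThorne2017, §6.2 Lemma 6.5 (3)] -/
def heckeRepHom₂ {α : 𝒢} (hα : α ∈ Δ) : Rep.of (rep ι Δ τ U') ⟶ Rep.of (rep ι Δ τ U) :=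
  Rep.ofHom ⟨(heckeOp₂ Δ (fnAction Δ τ) U U' α).restrict fun _ hf => heckeOp₂_apply_mem hU hU' hα hf,
    fun γ => LinearMap.ext fun f => Subtype.ext (by
      simp only [LinearMap.coe_comp, Function.comp_apply, LinearMap.coe_restrict_apply, coe_rep_apply]
      exact heckeOp₂_leftTranslation ι Δ τ U U' α γ f)⟩

/-- Unfolding `heckeRepHom₂`. [folklore] -/
@[simp]
theorem heckeRepHom₂_hom_apply_coe {α : 𝒢} (hα : α ∈ Δ) (f : sections Δ τ U') :
    ((heckeRepHom₂ ι Δ τ hU hU' hα).hom f : 𝒢 → V) = heckeOp₂ Δ (fnAction Δ τ) U U' α f := rfl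

/-- **`H^i([U α U']) : H^i(U', τ) → H^i(U, τ)`**. [cite: KhareThorne2017, §6.2 Lemma 6.5 (3)] -/
abbrev heckeCohomology₂ {α : 𝒢} (hα : α ∈ Δ) (i : ℕ) : cohomology ι Δ τ U' i ⟶ cohomology ι Δ τ U i :=
  groupCohomology.map (MonoidHom.id Γ) (heckeRepHom₂ ι Δ τ hU hU' hα) i

/-- **`[U α U'] ≫ res = [U' α U']`** (`C₁`: `U α U' = U' α U'`). [cite: KhareThorne2017, §6.2 Lemma 6.5 (3)] -/
theorem heckeRepHom₂_comp_resRepHom_of_C₁ {α : 𝒢} (hα : α ∈ Δ)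
    (hC₁ : ∀ l ∈ U, ∃ l' ∈ U', (((l * α : 𝒢)) : 𝒢 ⧸ U') = ((l' * α : 𝒢) : 𝒢 ⧸ U')) :
    heckeRepHom₂ ι Δ τ hU hU' hα ≫ resRepHom ι Δ τ hle = heckeRepHom ι Δ τ U' hU' hα := by
  refine Rep.hom_ext (Representation.IntertwiningMap.ext (LinearMap.ext fun f => ?_))
  change (resRepHom ι Δ τ hle).hom ((heckeRepHom₂ ι Δ τ hU hU' hα).hom f) = _
  refine Subtype.ext ?_
  rw [resRepHom_hom_apply_coe, heckeRepHom₂_hom_apply_coe]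
  exact heckeOp₂_eq_heckeOp_of_C₁ hle hC₁ _

/-- **`res ≫ [U α U'] = [U α U]`** (`C₂`: stabiliser condition). [cite: KhareThorne2017, §6.3 Lemma 6.10 (proof)] -/
theorem resRepHom_comp_heckeRepHom₂_of_C₂ {α : 𝒢} (hα : α ∈ Δ)
    (hC₂ : ∀ l ∈ U, (((l * α : 𝒢)) : 𝒢 ⧸ U) = (α : 𝒢 ⧸ U) → (((l * α : 𝒢)) : 𝒢 ⧸ U') = (α : 𝒢 ⧸ U')) :
    resRepHom ι Δ τ hle ≫ heckeRepHom₂ ι Δ τ hU hU' hα = heckeRepHom ι Δ τ U hU hα := by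
  refine Rep.hom_ext (Representation.IntertwiningMap.ext (LinearMap.ext fun f => ?_))
  change (heckeRepHom₂ ι Δ τ hU hU' hα).hom ((resRepHom ι Δ τ hle).hom f) = _
  refine Subtype.ext ?_
  rw [heckeRepHom₂_hom_apply_coe, resRepHom_hom_apply_coe]
  exact heckeOp₂_eq_heckeOp_of_C₂ hU hU' hle hα hC₂ f.2

/-- `H^i([U α U']) ≫ res = H^i([U' α U'])` (`C₁`). [cite: KhareThorne2017, §6.2 Lemma 6.5 (3)] -/
theorem heckeCohomology₂_comp_resCohomology_of_C₁ {α : 𝒢} (hα : α ∈ Δ)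
    (hC₁ : ∀ l ∈ U, ∃ l' ∈ U', (((l * α : 𝒢)) : 𝒢 ⧸ U') = ((l' * α : 𝒢) : 𝒢 ⧸ U')) (i : ℕ) :
    heckeCohomology₂ ι Δ τ hU hU' hα i ≫ resCohomology ι Δ τ hle i =
      groupCohomology.map (MonoidHom.id Γ) (heckeRepHom ι Δ τ U' hU' hα) i := by
  rw [heckeCohomology₂, resCohomology, ← groupCohomology.map_id_comp,
    heckeRepHom₂_comp_resRepHom_of_C₁ ι Δ τ hU hU' hle hα hC₁]

/-- `res ≫ H^i([U α U']) = H^i([U α U])` (`C₂`). [cite: KhareThorne2017, §6.3 Lemma 6.10 (proof)] -/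
theorem resCohomology_comp_heckeCohomology₂_of_C₂ {α : 𝒢} (hα : α ∈ Δ)
    (hC₂ : ∀ l ∈ U, (((l * α : 𝒢)) : 𝒢 ⧸ U) = (α : 𝒢 ⧸ U) → (((l * α : 𝒢)) : 𝒢 ⧸ U') = (α : 𝒢 ⧸ U')) (i : ℕ) :
    resCohomology ι Δ τ hle i ≫ heckeCohomology₂ ι Δ τ hU hU' hα i =
      groupCohomology.map (MonoidHom.id Γ) (heckeRepHom ι Δ τ U hU hα) i := by
  rw [heckeCohomology₂, resCohomology, ← groupCohomology.map_id_comp,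
    resRepHom_comp_heckeRepHom₂_of_C₂ ι Δ τ hU hU' hle hα hC₂]

/-- **Hida's lemma in the coefficients-at-`p` model (finiteness-free form).**  Under `C₁`, `C₂`, for
subspaces `V₀ ⊆ H^i(U, τ)`, `W₀ ⊆ H^i(U', τ)` exchanged by `res` and `[U α U']`, on which `[UαU]` is
injective resp. `[U'αU']` surjective, `res : V₀ → W₀` is a bijection. [cite: KhareThorne2017, §6.3, Lemma 6.10] -/
theorem bijOn_resCohomology_of_C₁_C₂ {α : 𝒢} (hα : α ∈ Δ)
    (hC₁ : ∀ l ∈ U, ∃ l' ∈ U', (((l * α : 𝒢)) : 𝒢 ⧸ U') = ((l' * α : 𝒢) : 𝒢 ⧸ U'))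
    (hC₂ : ∀ l ∈ U, (((l * α : 𝒢)) : 𝒢 ⧸ U) = (α : 𝒢 ⧸ U) → (((l * α : 𝒢)) : 𝒢 ⧸ U') = (α : 𝒢 ⧸ U'))
    (i : ℕ) {V₀ : Set (cohomology ι Δ τ U i)} {W₀ : Set (cohomology ι Δ τ U' i)}
    (hres : Set.MapsTo (resCohomology ι Δ τ hle i).hom V₀ W₀)
    (hT : Set.MapsTo (heckeCohomology₂ ι Δ τ hU hU' hα i).hom W₀ V₀)
    (hinj : Set.InjOn (heckeCohomology ι Δ τ U hU hα i) V₀)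
    (hsurj : Set.SurjOn (heckeCohomology ι Δ τ U' hU' hα i) W₀ W₀) :
    Set.BijOn (resCohomology ι Δ τ hle i).hom V₀ W₀ := by
  have h₁ := congrArg ModuleCat.Hom.hom (resCohomology_comp_heckeCohomology₂_of_C₂ ι Δ τ hU hU' hle hα hC₂ i)
  have h₂ := congrArg ModuleCat.Hom.hom (heckeCohomology₂_comp_resCohomology_of_C₁ ι Δ τ hU hU' hle hα hC₁ i)
  rw [ModuleCat.hom_comp] at h₁ h₂
  exact bijOn_of_comp_eq h₁ h₂ hres hT hinj hsurj

/-- `res` intertwines `[UαU]` and `[U'αU']` under `C₁`, `C₂`. [cite: KhareThorne2017, §6.3] -/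
theorem resCohomology_comp_eq_of_C₁_C₂ {α : 𝒢} (hα : α ∈ Δ)
    (hC₁ : ∀ l ∈ U, ∃ l' ∈ U', (((l * α : 𝒢)) : 𝒢 ⧸ U') = ((l' * α : 𝒢) : 𝒢 ⧸ U'))
    (hC₂ : ∀ l ∈ U, (((l * α : 𝒢)) : 𝒢 ⧸ U) = (α : 𝒢 ⧸ U) → (((l * α : 𝒢)) : 𝒢 ⧸ U') = (α : 𝒢 ⧸ U'))
    (i : ℕ) :
    (resCohomology ι Δ τ hle i).hom ∘ₗ heckeCohomology ι Δ τ U hU hα i =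
      heckeCohomology ι Δ τ U' hU' hα i ∘ₗ (resCohomology ι Δ τ hle i).hom := by
  have h₁ := congrArg ModuleCat.Hom.hom (resCohomology_comp_heckeCohomology₂_of_C₂ ι Δ τ hU hU' hle hα hC₂ i)
  have h₂ := congrArg ModuleCat.Hom.hom (heckeCohomology₂_comp_resCohomology_of_C₁ ι Δ τ hU hU' hle hα hC₁ i)
  rw [ModuleCat.hom_comp] at h₁ h₂
  exact comp_eq_comp_of_comp_eq h₁ h₂

/-- **Hida's lemma on `⋂ₘ range [UαU]^m`.**  Under `C₁`, `C₂`, if `[UαU]` is injective on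
`⋂ₘ [UαU]^m H^i(U, τ)` and `[U'αU']` maps `⋂ₘ [U'αU']^m H^i(U', τ)` onto itself (automatic for
finite or complete finitely generated modules), `res` restricts to a bijection between them.
[cite: KhareThorne2017, §6.3, Lemma 6.10] -/
theorem bijOn_resCohomology_iInf_range_of_C₁_C₂ {α : 𝒢} (hα : α ∈ Δ)
    (hC₁ : ∀ l ∈ U, ∃ l' ∈ U', (((l * α : 𝒢)) : 𝒢 ⧸ U') = ((l' * α : 𝒢) : 𝒢 ⧸ U'))
    (hC₂ : ∀ l ∈ U, (((l * α : 𝒢)) : 𝒢 ⧸ U) = (α : 𝒢 ⧸ U) → (((l * α : 𝒢)) : 𝒢 ⧸ U') = (α : 𝒢 ⧸ U'))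
    (i : ℕ)
    (hinj : Set.InjOn (heckeCohomology ι Δ τ U hU hα i)
      (⨅ m : ℕ, LinearMap.range (heckeCohomology ι Δ τ U hU hα i ^ m) : Submodule R (cohomology ι Δ τ U i)))
    (hsurj : Set.SurjOn (heckeCohomology ι Δ τ U' hU' hα i)
      (⨅ m : ℕ, LinearMap.range (heckeCohomology ι Δ τ U' hU' hα i ^ m) : Submodule R (cohomology ι Δ τ U' i))
      (⨅ m : ℕ, LinearMap.range (heckeCohomology ι Δ τ U' hU' hα i ^ m) : Submodule R (cohomology ι Δ τ U' i))) :
    Set.BijOn (resCohomology ι Δ τ hle i).hom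
      (⨅ m : ℕ, LinearMap.range (heckeCohomology ι Δ τ U hU hα i ^ m) : Submodule R (cohomology ι Δ τ U i))
      (⨅ m : ℕ, LinearMap.range (heckeCohomology ι Δ τ U' hU' hα i ^ m) : Submodule R (cohomology ι Δ τ U' i)) := by
  have h₁ := congrArg ModuleCat.Hom.hom (resCohomology_comp_heckeCohomology₂_of_C₂ ι Δ τ hU hU' hle hα hC₂ i)
  have h₂ := congrArg ModuleCat.Hom.hom (heckeCohomology₂_comp_resCohomology_of_C₁ ι Δ τ hU hU' hle hα hC₁ i)
  rw [ModuleCat.hom_comp] at h₁ h₂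
  refine bijOn_of_comp_eq h₁ h₂ (BigHeckeGLn.mapsTo_iInf_range_pow_of_comp_eq (comp_eq_comp_of_comp_eq h₁ h₂))
    (BigHeckeGLn.mapsTo_iInf_range_pow_of_comp_eq ?_) hinj hsurj
  -- `[U α U']` intertwines `[U'αU']` and `[UαU]`: `T ∘ U' = (T ∘ res) ∘ T = U ∘ T`
  dsimp only [heckeCohomology]
  rw [← h₂, ← LinearMap.comp_assoc, h₁]

end Generic

/-! ### The `GL₂` one-place level step -/

section LevelAt

open BigHeckeGLn

variable {K : Type} [Field K] [NumberField K] {p : ℕ} [Fact p.Prime] {𝒰 : TameLevel 2 K p}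
  {Λ Λ' : ∀ v : {v : HeightOneSpectrum (𝓞 K) // (p : 𝓞 K) ∈ v.asIdeal}, Subgroup (GL (Fin 2) (v.1.adicCompletion K))}
  {v : HeightOneSpectrum (𝓞 K)} (hv : (p : 𝓞 K) ∈ v.asIdeal) {b c : ℕ}
  (hΛv : Λ ⟨v, hv⟩ = iwahoriLevel 2 v b c) (hΛ'v : Λ' ⟨v, hv⟩ = iwahoriLevel 2 v b (c + 1))
  (hΛ' : ∀ w : {w : HeightOneSpectrum (𝓞 K) // (p : 𝓞 K) ∈ w.asIdeal}, w.1 ≠ v → Λ' w = Λ w)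
  {R : Type} [CommRing R] {Γ : Type} [Group Γ] (ι : Γ →* FiniteAdelicGL 2 K)
  (Δ : Submonoid (FiniteAdelicGL 2 K)) {V : Type} [AddCommGroup V] [Module R V] (τ : Δ →* Module.End R V)
  (hU : (𝒰.levelAt Λ).toSubmonoid ≤ Δ) (hU' : (𝒰.levelAt Λ').toSubmonoid ≤ Δ) (ht : heckeElement 2 K v 1 ∈ Δ)

include hΛv hΛ'v hΛ' in
/-- **Hida's lemma for `GL₂` in the coefficients-at-`p` model** (`U` maximal above `p`,
`Λ_v = Iw_v(b,c)`, `Λ'_v = Iw_v(b,c+1)`, `1 ≤ c`, `b ≤ c + 1`, `t = t_{v,1}`): if `U_v` is injective on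
`⋂ₘ U_v^m H^i(levelAt Λ, τ)` and `U_v'` maps `⋂ₘ U_v'^m H^i(levelAt Λ', τ)` onto itself, then `res`
restricts to a bijection between these. [cite: KhareThorne2017, §6.3, Lemma 6.10] [cite: Hida1994AIF, §2] -/
theorem bijOn_resCohomology_iInf_range_levelAt (h𝒰 : 𝒰.IsMaximalAbove) (hc : 1 ≤ c) (hbc : b ≤ c + 1)
    (i : ℕ)
    (hinj : Set.InjOn (heckeCohomology ι Δ τ (𝒰.levelAt Λ) hU ht i)
      (⨅ m : ℕ, LinearMap.range (heckeCohomology ι Δ τ (𝒰.levelAt Λ) hU ht i ^ m) : Submodule R _))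
    (hsurj : Set.SurjOn (heckeCohomology ι Δ τ (𝒰.levelAt Λ') hU' ht i)
      (⨅ m : ℕ, LinearMap.range (heckeCohomology ι Δ τ (𝒰.levelAt Λ') hU' ht i ^ m) : Submodule R _)
      (⨅ m : ℕ, LinearMap.range (heckeCohomology ι Δ τ (𝒰.levelAt Λ') hU' ht i ^ m) : Submodule R _)) :
    Set.BijOn (resCohomology ι Δ τ (𝒰.levelAt_le_levelAt_of_succ hv hΛv hΛ'v hΛ') i).hom
      (⨅ m : ℕ, LinearMap.range (heckeCohomology ι Δ τ (𝒰.levelAt Λ) hU ht i ^ m) : Submodule R _)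
      (⨅ m : ℕ, LinearMap.range (heckeCohomology ι Δ τ (𝒰.levelAt Λ') hU' ht i ^ m) : Submodule R _) :=
  bijOn_resCohomology_iInf_range_of_C₁_C₂ ι Δ τ hU hU' (𝒰.levelAt_le_levelAt_of_succ hv hΛv hΛ'v hΛ') ht
    (𝒰.exists_levelAt_coset_eq hv hΛv hΛ'v hΛ' h𝒰 hc hbc) (𝒰.levelAt_coset_eq_of_conj_mem hv hΛv hΛ'v hΛ' hbc)
    i hinj hsurj

include hΛv hΛ'v hΛ' in
/-- `res : H^i(levelAt Λ, τ) → H^i(levelAt Λ', τ)` intertwines `U_v` at the two levels. [cite: KhareThorne2017, §6.2, Lemma 6.5 (2)] -/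
theorem resCohomology_comp_heckeCohomology_levelAt (h𝒰 : 𝒰.IsMaximalAbove) (hc : 1 ≤ c) (hbc : b ≤ c + 1)
    (i : ℕ) :
    (resCohomology ι Δ τ (𝒰.levelAt_le_levelAt_of_succ hv hΛv hΛ'v hΛ') i).hom ∘ₗ
        heckeCohomology ι Δ τ (𝒰.levelAt Λ) hU ht i =
      heckeCohomology ι Δ τ (𝒰.levelAt Λ') hU' ht i ∘ₗ
        (resCohomology ι Δ τ (𝒰.levelAt_le_levelAt_of_succ hv hΛv hΛ'v hΛ') i).hom :=
  resCohomology_comp_eq_of_C₁_C₂ ι Δ τ hU hU' (𝒰.levelAt_le_levelAt_of_succ hv hΛv hΛ'v hΛ') ht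
    (𝒰.exists_levelAt_coset_eq hv hΛv hΛ'v hΛ' h𝒰 hc hbc) (𝒰.levelAt_coset_eq_of_conj_mem hv hΛv hΛ'v hΛ' hbc) i

end LevelAt

end Literature.NumberTheory.Automorphic.LevelAction
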